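import Summits.QuantumFields.YangMills.Theorems.UnitScaleTiltProp7CommutatorChain
import HarnessLib

/-!
# Route `UnitScaleTilt`, crux K1 «MinimiserStabilityRegPr» (stmt-QuantumFields-19200), route-R E′, S3 K-form engine, ROW (H) — hLap INHABITANT, FILE A (abstract letters):
# THE DOUBLE CHAIN RULE — the commutator of a fixed element `m` with the QUOTIENT `g′⁻¹g` of two thin loops grown rung by rung (`g(k+1) = T_kP_kT_k⁻¹·g(k)`,
# `g′(k+1) = T′_kP′_kT′_k⁻¹·g′(k)`) is bounded by the commutators of `m` with the RUNG DIFFERENCES `T_kP_kT_k⁻¹ − T′_kP′_kT′_k⁻¹` (transported plaquette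
# differences) plus second-order terms `‖rung − rung′‖ ×` single-chain commutator sums

Cell `ym3-torus`, width seat `ym3-torus-px4` (gen 4); ★ym-ust-19200-p1 g16 NAMER WORD 14 «px4 g4: hLap INHABITANT GO» (2026-08-29 00:17Z), road (iii) of ★w4 g7's second read
(00:26Z) of this seat's LOCATE-HLAP (19200 evidence #46).  THEOREMS ONLY (0 `def`, 0 `sorry`); `--supports stmt-QuantumFields-19200`, count-neutral.  YM₃ on T³ is a ladder rung
(R3), not the Clay problem; nothing here claims hLap, hRes, (H), S3, E′, a stub, the crux, d = 4 or the mass gap.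

WHY.  routeR-w1's ✓ `Prop7AxialLocalModel.norm_lap_axialModel_le` books the covariant Laplacian of a comb local model `Ψ = R(axialT⁻¹)m` at a site by
`Σ_μ (N_m(h(x−e_μ,μ)⁻¹·h(x,μ)) + 2‖h(x−e_μ,μ) − 1‖·N_m(h(x−e_μ,μ)))`, `N_m(u) = ‖u·m − m·u‖`, where `h(x,μ)`, `h(x−e_μ,μ)` are two ADJACENT PARALLEL thin loops through the centre
((27)-contours).  Each thin loop is a chain `g(n) = Π_(k<n) T_kP_kT_k⁻¹` of conjugated plaquettes (✓ `Prop7CommutatorChain.comm_chain_le` books `N_m(g(n))` by `Σ_k N_(R(T_k⁻¹)m)(P_k)`),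
and the two loops have the SAME rung structure, shifted by one lattice unit.  The first-order content of `N_m(g′⁻¹g)` is therefore the commutator of `m` with the DIFFERENCE of
corresponding rungs — a transported curvature difference (whose `μ`-sums along the comb legs are the Yang–Mills current plus the non-current remainder of the LOCATE) — and NOT
the sum of the two single-loop families (which would lose the cancellation).  This file is the abstract normed-ring half of that statement; the comb geometry, the localisation
of the rung differences, the regrouping into currents and the counts are separate files.

WHAT IS PROVED (ns `…Theorems.Prop7DoubleCommutatorChain`; `𝔸` a normed ring; «bi-contractive» = `‖u‖ ≤ 1 ∧ ‖u⁻¹‖ ≤ 1`; chains as in ✓ `comm_chain_le`).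
* §1 `comm_inv_mul_eq` (ring identity `[g′⁻¹g, m] = g′⁻¹([g,m] − [g′,m]) + g′⁻¹[g′,m](1 − g′⁻¹g)`), `comm_mul_eq` (`[XY,m] = X[Y,m] + [X,m]Y`),
  `norm_conj_sub_one_le` (`‖TPT⁻¹ − 1‖ ≤ ‖P − 1‖`), `norm_rung_sub_rung_le` (`‖TPT⁻¹ − T′P′T′⁻¹‖ ≤ ‖P − 1‖ + ‖P′ − 1‖`),
  ★ `comm_rung_sub_rung_le` (`N_m(TPT⁻¹ − T′P′T′⁻¹) ≤ N_(R(T⁻¹)m)(P − R(T⁻¹T′)P′)`: the rung difference read at the first rung's frame).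
* §2 `norm_chain_sub_chain_le` (`‖g(n) − g′(n)‖ ≤ Σ_(k<n) ‖C_k − C′_k‖`), ★★ `comm_chain_sub_chain_le` (the DIFFERENCE chain rule:
  `N_m(g(n) − g′(n)) ≤ Σ_(k<n) N_m(C_k − C′_k) + Σ_(k<n) (N_(R(T_k⁻¹)m)(P_k)·Σ_(i<k)‖C_i − C′_i‖ + ‖C_k − C′_k‖·Σ_(i<k) N_(R(T′_i⁻¹)m)(P′_i))`).
* §3 ★★★ `comm_double_chain_le` (`N_m(g′(n)⁻¹g(n)) ≤ [§2's bound] + (Σ_(i<n) N_(R(T′_i⁻¹)m)(P′_i))·Σ_(k<n)‖C_k − C′_k‖`), ★★ `comm_double_chain_le_of_small`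
  (plaquettes within `a` of `1`: `N_m(g′(n)⁻¹g(n)) ≤ Σ_(k<n) N_m(C_k − C′_k) + 2a·n·(Σ_k N_(R(T_k⁻¹)m)(P_k) + 2·Σ_k N_(R(T′_k⁻¹)m)(P′_k))`), `norm_R_double_chain_sub_self_le`
  (the same for `‖R(g′(n)⁻¹g(n))m − m‖`).
HONEST SCOPE.  Pure normed-ring algebra (triangle inequalities over two exact identities); no lattice, no background, no smallness beyond the displayed `‖P_k − 1‖ ≤ a`; the
torus∕comb instances and every count are NOT here.

References: T. Bałaban, CMP 98 (1985) 17–51 [Balaban1985Averaging] ((9) p.19, (19)–(20) p.21); CMP 99 (1985) 389–434 [Balaban1985BackgroundPropagators] ((3.3)–(3.4)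
pp.390–391, (3.8) p.392); CMP 99 (1985) 75–102 [Balaban1985RegularSpaces] ((1.1)–(1.2) p.76).
-/

set_option autoImplicit false

noncomputable section

open scoped BigOperators

namespace Summit.QuantumFields.YangMills.Theorems.Prop7DoubleCommutatorChain

open Literature.MathematicalPhysics.QuantumFieldTheory.Balaban1983to89
open B9Eq39Adjoint (R R_def)
open Summit.QuantumFields.YangMills.Theorems.Prop7CommutatorChain (comm_chain_le comm_conj_le norm_R_sub_self_le_comm_of_inv)

variable {𝔸 : Type*} [NormedRing 𝔸]

/-! ## §1 One rung: identities and the rung-difference commutator -/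

section Rung

/-- `[XY, m] = X[Y, m] + [X, m]Y`. [folklore] -/
theorem comm_mul_eq (X Y m : 𝔸) : X * Y * m - m * (X * Y) = X * (Y * m - m * Y) + (X * m - m * X) * Y := by
  noncomm_ring

/-- the ring identity behind the double chain rule: `[g′⁻¹g, m] = g′⁻¹([g,m] − [g′,m]) + g′⁻¹[g′,m](1 − g′⁻¹g)`. [folklore] -/
theorem comm_inv_mul_eq (g g' : 𝔸ˣ) (m : 𝔸) :
    ((g'⁻¹ * g : 𝔸ˣ) : 𝔸) * m - m * ((g'⁻¹ * g : 𝔸ˣ) : 𝔸)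
      = (((g'⁻¹ : 𝔸ˣ) : 𝔸) * (((g : 𝔸) * m - m * (g : 𝔸)) - ((g' : 𝔸) * m - m * (g' : 𝔸))))
        + ((g'⁻¹ : 𝔸ˣ) : 𝔸) * ((g' : 𝔸) * m - m * (g' : 𝔸)) * (1 - ((g'⁻¹ : 𝔸ˣ) : 𝔸) * (g : 𝔸)) := by
  have hab : ((g'⁻¹ : 𝔸ˣ) : 𝔸) * (g' : 𝔸) = 1 := Units.inv_mul g'
  have hba : (g' : 𝔸) * ((g'⁻¹ : 𝔸ˣ) : 𝔸) = 1 := Units.mul_inv g'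
  have key : (((g'⁻¹ : 𝔸ˣ) : 𝔸) * (((g : 𝔸) * m - m * (g : 𝔸)) - ((g' : 𝔸) * m - m * (g' : 𝔸))))
        + ((g'⁻¹ : 𝔸ˣ) : 𝔸) * ((g' : 𝔸) * m - m * (g' : 𝔸)) * (1 - ((g'⁻¹ : 𝔸ˣ) : 𝔸) * (g : 𝔸))
      = (((g'⁻¹ : 𝔸ˣ) : 𝔸) * (g : 𝔸) * m - m * (((g'⁻¹ : 𝔸ˣ) : 𝔸) * (g : 𝔸)))
        + (1 - ((g'⁻¹ : 𝔸ˣ) : 𝔸) * (g' : 𝔸)) * m * ((g'⁻¹ : 𝔸ˣ) : 𝔸) * (g : 𝔸)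
        + ((g'⁻¹ : 𝔸ˣ) : 𝔸) * m * ((g' : 𝔸) * ((g'⁻¹ : 𝔸ˣ) : 𝔸) - 1) * (g : 𝔸) := by
    noncomm_ring
  rw [key, hab, hba, Units.val_mul]
  simp

/-- `‖TPT⁻¹ − 1‖ ≤ ‖P − 1‖` for bi-contractive `T`. [folklore] -/
theorem norm_conj_sub_one_le {T : 𝔸ˣ} (hT : ‖(T : 𝔸)‖ ≤ 1 ∧ ‖((T⁻¹ : 𝔸ˣ) : 𝔸)‖ ≤ 1) (P : 𝔸ˣ) :
    ‖((T * P * T⁻¹ : 𝔸ˣ) : 𝔸) - 1‖ ≤ ‖(P : 𝔸) - 1‖ := by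
  have hK : (T : 𝔸) * ((T⁻¹ : 𝔸ˣ) : 𝔸) = 1 := Units.mul_inv T
  have e : ((T * P * T⁻¹ : 𝔸ˣ) : 𝔸) - 1 = (T : 𝔸) * ((P : 𝔸) - 1) * ((T⁻¹ : 𝔸ˣ) : 𝔸) := by
    rw [Units.val_mul, Units.val_mul, mul_sub, sub_mul, mul_one, hK]
  rw [e]
  calc ‖(T : 𝔸) * ((P : 𝔸) - 1) * ((T⁻¹ : 𝔸ˣ) : 𝔸)‖ ≤ ‖(T : 𝔸)‖ * ‖(P : 𝔸) - 1‖ * ‖((T⁻¹ : 𝔸ˣ) : 𝔸)‖ :=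
        (norm_mul_le _ _).trans (mul_le_mul_of_nonneg_right (norm_mul_le _ _) (norm_nonneg _))
    _ ≤ 1 * ‖(P : 𝔸) - 1‖ * 1 := mul_le_mul (mul_le_mul_of_nonneg_right hT.1 (norm_nonneg _)) hT.2 (norm_nonneg _) (by positivity)
    _ = ‖(P : 𝔸) - 1‖ := by ring

/-- `‖TPT⁻¹ − T′P′T′⁻¹‖ ≤ ‖P − 1‖ + ‖P′ − 1‖` for bi-contractive `T, T′`: a rung difference is (crudely) at most twice the small-field size. [folklore] -/
theorem norm_rung_sub_rung_le {T T' : 𝔸ˣ} (hT : ‖(T : 𝔸)‖ ≤ 1 ∧ ‖((T⁻¹ : 𝔸ˣ) : 𝔸)‖ ≤ 1) (hT' : ‖(T' : 𝔸)‖ ≤ 1 ∧ ‖((T'⁻¹ : 𝔸ˣ) : 𝔸)‖ ≤ 1)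
    (P P' : 𝔸ˣ) :
    ‖((T * P * T⁻¹ : 𝔸ˣ) : 𝔸) - ((T' * P' * T'⁻¹ : 𝔸ˣ) : 𝔸)‖ ≤ ‖(P : 𝔸) - 1‖ + ‖(P' : 𝔸) - 1‖ := by
  have e : ((T * P * T⁻¹ : 𝔸ˣ) : 𝔸) - ((T' * P' * T'⁻¹ : 𝔸ˣ) : 𝔸) = (((T * P * T⁻¹ : 𝔸ˣ) : 𝔸) - 1) - (((T' * P' * T'⁻¹ : 𝔸ˣ) : 𝔸) - 1) := by
    abel
  rw [e]
  exact (norm_sub_le _ _).trans (add_le_add (norm_conj_sub_one_le hT P) (norm_conj_sub_one_le hT' P'))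

/-- ★ **THE RUNG-DIFFERENCE COMMUTATOR READ AT THE FIRST RUNG's FRAME**: `N_m(TPT⁻¹ − T′P′T′⁻¹) ≤ N_(R(T⁻¹)m)(P − R(T⁻¹T′)P′)` for bi-contractive `T` — the difference of two
transported plaquettes, seen from the end of the first transport, is `P` minus the second plaquette re-transported by the loop `T⁻¹T′`.
[cite: Balaban1985RegularSpaces, (1.1)-(1.2) p.76; Balaban1985Averaging, (9) p.19] -/
theorem comm_rung_sub_rung_le {T : 𝔸ˣ} (hT : ‖(T : 𝔸)‖ ≤ 1 ∧ ‖((T⁻¹ : 𝔸ˣ) : 𝔸)‖ ≤ 1) (T' P P' : 𝔸ˣ) (m : 𝔸) :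
    ‖(((T * P * T⁻¹ : 𝔸ˣ) : 𝔸) - ((T' * P' * T'⁻¹ : 𝔸ˣ) : 𝔸)) * m - m * (((T * P * T⁻¹ : 𝔸ˣ) : 𝔸) - ((T' * P' * T'⁻¹ : 𝔸ˣ) : 𝔸))‖
      ≤ ‖((P : 𝔸) - R (T⁻¹ * T') (P' : 𝔸)) * R T⁻¹ m - R T⁻¹ m * ((P : 𝔸) - R (T⁻¹ * T') (P' : 𝔸))‖ := by
  have hK : (T : 𝔸) * ((T⁻¹ : 𝔸ˣ) : 𝔸) = 1 := Units.mul_inv T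
  have hK' : ((T⁻¹ : 𝔸ˣ) : 𝔸) * (T : 𝔸) = 1 := Units.inv_mul T
  -- the rung difference is `T · Y · T⁻¹` with `Y = P − R(T⁻¹T′)P′`
  set Y : 𝔸 := (P : 𝔸) - R (T⁻¹ * T') (P' : 𝔸) with hY
  have eD : ((T * P * T⁻¹ : 𝔸ˣ) : 𝔸) - ((T' * P' * T'⁻¹ : 𝔸ˣ) : 𝔸) = (T : 𝔸) * Y * ((T⁻¹ : 𝔸ˣ) : 𝔸) := by
    rw [hY, R_def, mul_inv_rev, inv_inv, Units.val_mul, Units.val_mul, Units.val_mul, Units.val_mul, Units.val_mul, Units.val_mul]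
    calc (T : 𝔸) * (P : 𝔸) * ((T⁻¹ : 𝔸ˣ) : 𝔸) - (T' : 𝔸) * (P' : 𝔸) * ((T'⁻¹ : 𝔸ˣ) : 𝔸)
        = (T : 𝔸) * (P : 𝔸) * ((T⁻¹ : 𝔸ˣ) : 𝔸) - ((T : 𝔸) * ((T⁻¹ : 𝔸ˣ) : 𝔸)) * (T' : 𝔸) * (P' : 𝔸) * ((T'⁻¹ : 𝔸ˣ) : 𝔸) * ((T : 𝔸) * ((T⁻¹ : 𝔸ˣ) : 𝔸)) := by
            rw [hK, one_mul, mul_one]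
      _ = _ := by noncomm_ring
  -- and `[T Y T⁻¹, m] = T [Y, R(T⁻¹)m] T⁻¹`
  have eC : ((T : 𝔸) * Y * ((T⁻¹ : 𝔸ˣ) : 𝔸)) * m - m * ((T : 𝔸) * Y * ((T⁻¹ : 𝔸ˣ) : 𝔸))
      = (T : 𝔸) * (Y * R T⁻¹ m - R T⁻¹ m * Y) * ((T⁻¹ : 𝔸ˣ) : 𝔸) := by
    rw [R_def, inv_inv]
    calc ((T : 𝔸) * Y * ((T⁻¹ : 𝔸ˣ) : 𝔸)) * m - m * ((T : 𝔸) * Y * ((T⁻¹ : 𝔸ˣ) : 𝔸))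
        = ((T : 𝔸) * Y * ((T⁻¹ : 𝔸ˣ) : 𝔸)) * m * ((T : 𝔸) * ((T⁻¹ : 𝔸ˣ) : 𝔸)) - ((T : 𝔸) * ((T⁻¹ : 𝔸ˣ) : 𝔸)) * m * ((T : 𝔸) * Y * ((T⁻¹ : 𝔸ˣ) : 𝔸)) := by
            rw [hK, mul_one, one_mul]
      _ = _ := by noncomm_ring
  rw [eD, eC]
  calc ‖(T : 𝔸) * (Y * R T⁻¹ m - R T⁻¹ m * Y) * ((T⁻¹ : 𝔸ˣ) : 𝔸)‖
      ≤ ‖(T : 𝔸)‖ * ‖Y * R T⁻¹ m - R T⁻¹ m * Y‖ * ‖((T⁻¹ : 𝔸ˣ) : 𝔸)‖ :=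
        (norm_mul_le _ _).trans (mul_le_mul_of_nonneg_right (norm_mul_le _ _) (norm_nonneg _))
    _ ≤ 1 * ‖Y * R T⁻¹ m - R T⁻¹ m * Y‖ * 1 := mul_le_mul (mul_le_mul_of_nonneg_right hT.1 (norm_nonneg _)) hT.2 (norm_nonneg _) (by positivity)
    _ = _ := by ring

end Rung

/-! ## §2 Two chains with the same rung structure: the difference chain rule -/

section Chains

/-- `‖g(n) − g′(n)‖ ≤ Σ_(k<n) ‖C_k − C′_k‖`, `C_k = T_kP_kT_k⁻¹` (telescoping `g(k+1) − g′(k+1) = C_k(g(k) − g′(k)) + (C_k − C′_k)g′(k)`, every factor of norm `≤ 1`). [folklore] -/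
theorem norm_chain_sub_chain_le (T P T' P' g g' : ℕ → 𝔸ˣ)
    (hT : ∀ k, ‖(T k : 𝔸)‖ ≤ 1 ∧ ‖(((T k)⁻¹ : 𝔸ˣ) : 𝔸)‖ ≤ 1) (hP : ∀ k, ‖(P k : 𝔸)‖ ≤ 1 ∧ ‖(((P k)⁻¹ : 𝔸ˣ) : 𝔸)‖ ≤ 1)
    (h0 : g 0 = 1) (hs : ∀ k, g (k + 1) = (T k * P k * (T k)⁻¹) * g k)
    (hg' : ∀ k, ‖(g' k : 𝔸)‖ ≤ 1 ∧ ‖(((g' k)⁻¹ : 𝔸ˣ) : 𝔸)‖ ≤ 1) (h0' : g' 0 = 1) (hs' : ∀ k, g' (k + 1) = (T' k * P' k * (T' k)⁻¹) * g' k) :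
    ∀ n : ℕ, ‖(g n : 𝔸) - (g' n : 𝔸)‖ ≤ ∑ k ∈ Finset.range n, ‖((T k * P k * (T k)⁻¹ : 𝔸ˣ) : 𝔸) - ((T' k * P' k * (T' k)⁻¹ : 𝔸ˣ) : 𝔸)‖
  | 0 => by rw [h0, h0']; simp
  | n + 1 => by
    set C : 𝔸 := ((T n * P n * (T n)⁻¹ : 𝔸ˣ) : 𝔸) with hC
    set C' : 𝔸 := ((T' n * P' n * (T' n)⁻¹ : 𝔸ˣ) : 𝔸) with hC'
    have eg : ((g (n + 1) : 𝔸ˣ) : 𝔸) = C * (g n : 𝔸) := by rw [hC, ← Units.val_mul, ← hs n]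
    have eg' : ((g' (n + 1) : 𝔸ˣ) : 𝔸) = C' * (g' n : 𝔸) := by rw [hC', ← Units.val_mul, ← hs' n]
    have e : C * (g n : 𝔸) - C' * (g' n : 𝔸) = C * ((g n : 𝔸) - (g' n : 𝔸)) + (C - C') * (g' n : 𝔸) := by noncomm_ring
    rw [Finset.sum_range_succ, eg, eg', e]
    have hCn : ‖C‖ ≤ 1 := by
      rw [hC, Units.val_mul, Units.val_mul]
      calc ‖(T n : 𝔸) * (P n : 𝔸) * (((T n)⁻¹ : 𝔸ˣ) : 𝔸)‖ ≤ ‖(T n : 𝔸)‖ * ‖(P n : 𝔸)‖ * ‖(((T n)⁻¹ : 𝔸ˣ) : 𝔸)‖ :=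
            (norm_mul_le _ _).trans (mul_le_mul_of_nonneg_right (norm_mul_le _ _) (norm_nonneg _))
        _ ≤ 1 * 1 * 1 := mul_le_mul (mul_le_mul (hT n).1 (hP n).1 (norm_nonneg _) zero_le_one) (hT n).2 (norm_nonneg _) (by positivity)
        _ = 1 := by ring
    have ih := norm_chain_sub_chain_le T P T' P' g g' hT hP h0 hs hg' h0' hs' n
    refine (norm_add_le _ _).trans (add_le_add ?_ ?_)
    · exact (norm_mul_le _ _).trans (by nlinarith [norm_nonneg ((g n : 𝔸) - (g' n : 𝔸)), norm_nonneg C])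
    · exact (norm_mul_le _ _).trans (by nlinarith [norm_nonneg (C - C'), (hg' n).1])

/-- ★★ **THE DIFFERENCE CHAIN RULE**: with `C_k = T_kP_kT_k⁻¹`, `C′_k = T′_kP′_kT′_k⁻¹`,
`N_m(g(n) − g′(n)) ≤ Σ_(k<n) N_m(C_k − C′_k) + Σ_(k<n) (N_(R(T_k⁻¹)m)(P_k)·Σ_(i<k)‖C_i − C′_i‖ + ‖C_k − C′_k‖·Σ_(i<k) N_(R(T′_i⁻¹)m)(P′_i))` — first order: the commutators with the
RUNG DIFFERENCES; second order: rung commutators times accumulated rung differences (`[C(X) + ΔB, m] = C[X,m] + [C,m]X + Δ[B,m] + [Δ,m]B`, ✓ `comm_chain_le` for `[B,m] = [g′(k),m]`).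
[cite: Balaban1985Averaging, (9) p.19, (19)-(20) p.21; Balaban1985BackgroundPropagators, (3.3)-(3.4) pp.390-391] -/
theorem comm_chain_sub_chain_le [NormOneClass 𝔸] (T P T' P' g g' : ℕ → 𝔸ˣ)
    (hT : ∀ k, ‖(T k : 𝔸)‖ ≤ 1 ∧ ‖(((T k)⁻¹ : 𝔸ˣ) : 𝔸)‖ ≤ 1) (hP : ∀ k, ‖(P k : 𝔸)‖ ≤ 1 ∧ ‖(((P k)⁻¹ : 𝔸ˣ) : 𝔸)‖ ≤ 1)
    (h0 : g 0 = 1) (hs : ∀ k, g (k + 1) = (T k * P k * (T k)⁻¹) * g k)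
    (hT' : ∀ k, ‖(T' k : 𝔸)‖ ≤ 1 ∧ ‖(((T' k)⁻¹ : 𝔸ˣ) : 𝔸)‖ ≤ 1) (hP' : ∀ k, ‖(P' k : 𝔸)‖ ≤ 1 ∧ ‖(((P' k)⁻¹ : 𝔸ˣ) : 𝔸)‖ ≤ 1)
    (hg' : ∀ k, ‖(g' k : 𝔸)‖ ≤ 1 ∧ ‖(((g' k)⁻¹ : 𝔸ˣ) : 𝔸)‖ ≤ 1) (h0' : g' 0 = 1) (hs' : ∀ k, g' (k + 1) = (T' k * P' k * (T' k)⁻¹) * g' k) (m : 𝔸) :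
    ∀ n : ℕ, ‖((g n : 𝔸) - (g' n : 𝔸)) * m - m * ((g n : 𝔸) - (g' n : 𝔸))‖
      ≤ ∑ k ∈ Finset.range n, ‖(((T k * P k * (T k)⁻¹ : 𝔸ˣ) : 𝔸) - ((T' k * P' k * (T' k)⁻¹ : 𝔸ˣ) : 𝔸)) * m
            - m * (((T k * P k * (T k)⁻¹ : 𝔸ˣ) : 𝔸) - ((T' k * P' k * (T' k)⁻¹ : 𝔸ˣ) : 𝔸))‖
        + ∑ k ∈ Finset.range n, (‖(P k : 𝔸) * R (T k)⁻¹ m - R (T k)⁻¹ m * (P k : 𝔸)‖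
              * ∑ i ∈ Finset.range k, ‖((T i * P i * (T i)⁻¹ : 𝔸ˣ) : 𝔸) - ((T' i * P' i * (T' i)⁻¹ : 𝔸ˣ) : 𝔸)‖
            + ‖((T k * P k * (T k)⁻¹ : 𝔸ˣ) : 𝔸) - ((T' k * P' k * (T' k)⁻¹ : 𝔸ˣ) : 𝔸)‖
              * ∑ i ∈ Finset.range k, ‖(P' i : 𝔸) * R (T' i)⁻¹ m - R (T' i)⁻¹ m * (P' i : 𝔸)‖)
  | 0 => by rw [h0, h0']; simp
  | n + 1 => by
    set C : 𝔸 := ((T n * P n * (T n)⁻¹ : 𝔸ˣ) : 𝔸) with hC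
    set C' : 𝔸 := ((T' n * P' n * (T' n)⁻¹ : 𝔸ˣ) : 𝔸) with hC'
    have eg : ((g (n + 1) : 𝔸ˣ) : 𝔸) = C * (g n : 𝔸) := by rw [hC, ← Units.val_mul, ← hs n]
    have eg' : ((g' (n + 1) : 𝔸ˣ) : 𝔸) = C' * (g' n : 𝔸) := by rw [hC', ← Units.val_mul, ← hs' n]
    rw [Finset.sum_range_succ, Finset.sum_range_succ, eg, eg']
    -- the four-term expansion
    have e : (C * (g n : 𝔸) - C' * (g' n : 𝔸)) * m - m * (C * (g n : 𝔸) - C' * (g' n : 𝔸))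
        = C * (((g n : 𝔸) - (g' n : 𝔸)) * m - m * ((g n : 𝔸) - (g' n : 𝔸))) + (C * m - m * C) * ((g n : 𝔸) - (g' n : 𝔸))
          + (C - C') * ((g' n : 𝔸) * m - m * (g' n : 𝔸)) + ((C - C') * m - m * (C - C')) * (g' n : 𝔸) := by
      noncomm_ring
    rw [e]
    have hCn : ‖C‖ ≤ 1 := by
      rw [hC, Units.val_mul, Units.val_mul]
      calc ‖(T n : 𝔸) * (P n : 𝔸) * (((T n)⁻¹ : 𝔸ˣ) : 𝔸)‖ ≤ ‖(T n : 𝔸)‖ * ‖(P n : 𝔸)‖ * ‖(((T n)⁻¹ : 𝔸ˣ) : 𝔸)‖ :=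
            (norm_mul_le _ _).trans (mul_le_mul_of_nonneg_right (norm_mul_le _ _) (norm_nonneg _))
        _ ≤ 1 * 1 * 1 := mul_le_mul (mul_le_mul (hT n).1 (hP n).1 (norm_nonneg _) zero_le_one) (hT n).2 (norm_nonneg _) (by positivity)
        _ = 1 := by ring
    -- the four ingredients
    have ih := comm_chain_sub_chain_le T P T' P' g g' hT hP h0 hs hT' hP' hg' h0' hs' m n
    have hXn : ‖(g n : 𝔸) - (g' n : 𝔸)‖ ≤ ∑ i ∈ Finset.range n, ‖((T i * P i * (T i)⁻¹ : 𝔸ˣ) : 𝔸) - ((T' i * P' i * (T' i)⁻¹ : 𝔸ˣ) : 𝔸)‖ :=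
      norm_chain_sub_chain_le T P T' P' g g' hT hP h0 hs hg' h0' hs' n
    have hNC : ‖C * m - m * C‖ ≤ ‖(P n : 𝔸) * R (T n)⁻¹ m - R (T n)⁻¹ m * (P n : 𝔸)‖ := by rw [hC]; exact comm_conj_le (hT n) (P n) m
    have hB : ‖(g' n : 𝔸) * m - m * (g' n : 𝔸)‖ ≤ ∑ i ∈ Finset.range n, ‖(P' i : 𝔸) * R (T' i)⁻¹ m - R (T' i)⁻¹ m * (P' i : 𝔸)‖ :=
      comm_chain_le T' P' g' hT' hP' hg' h0' hs' m n
    -- assemble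
    have t1 : ‖C * (((g n : 𝔸) - (g' n : 𝔸)) * m - m * ((g n : 𝔸) - (g' n : 𝔸)))‖ ≤ ‖((g n : 𝔸) - (g' n : 𝔸)) * m - m * ((g n : 𝔸) - (g' n : 𝔸))‖ :=
      (norm_mul_le _ _).trans (by nlinarith [norm_nonneg (((g n : 𝔸) - (g' n : 𝔸)) * m - m * ((g n : 𝔸) - (g' n : 𝔸)))])
    have t2 : ‖(C * m - m * C) * ((g n : 𝔸) - (g' n : 𝔸))‖ ≤ ‖(P n : 𝔸) * R (T n)⁻¹ m - R (T n)⁻¹ m * (P n : 𝔸)‖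
        * ∑ i ∈ Finset.range n, ‖((T i * P i * (T i)⁻¹ : 𝔸ˣ) : 𝔸) - ((T' i * P' i * (T' i)⁻¹ : 𝔸ˣ) : 𝔸)‖ :=
      (norm_mul_le _ _).trans (mul_le_mul hNC hXn (norm_nonneg _) (norm_nonneg _))
    have t3 : ‖(C - C') * ((g' n : 𝔸) * m - m * (g' n : 𝔸))‖ ≤ ‖C - C'‖ * ∑ i ∈ Finset.range n, ‖(P' i : 𝔸) * R (T' i)⁻¹ m - R (T' i)⁻¹ m * (P' i : 𝔸)‖ :=
      (norm_mul_le _ _).trans (mul_le_mul_of_nonneg_left hB (norm_nonneg _))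
    have t4 : ‖((C - C') * m - m * (C - C')) * (g' n : 𝔸)‖ ≤ ‖(C - C') * m - m * (C - C')‖ :=
      (norm_mul_le _ _).trans (by nlinarith [norm_nonneg ((C - C') * m - m * (C - C')), (hg' n).1])
    have s := (norm_add_le _ _).trans (add_le_add ((norm_add_le _ _).trans (add_le_add ((norm_add_le _ _).trans (add_le_add t1 t2)) t3)) t4)
    refine s.trans ?_
    linarith [ih]

end Chains

/-! ## §3 The double chain rule -/

section Double

variable [NormOneClass 𝔸]

/-- ★★★ **THE DOUBLE CHAIN RULE**: `N_m(g′(n)⁻¹g(n)) ≤ Σ_(k<n) N_m(C_k − C′_k) + Σ_(k<n)(N_(R(T_k⁻¹)m)(P_k)·Σ_(i<k)‖C_i − C′_i‖ + ‖C_k − C′_k‖·Σ_(i<k)N_(R(T′_i⁻¹)m)(P′_i))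
+ (Σ_(i<n) N_(R(T′_i⁻¹)m)(P′_i))·Σ_(k<n)‖C_k − C′_k‖` — the commutator with the quotient of two parallel thin loops is the commutator with the RUNG DIFFERENCES plus second order
(§1 `comm_inv_mul_eq`: `‖g′⁻¹([g,m]−[g′,m])‖ ≤ N_m(g − g′)`, `‖g′⁻¹[g′,m](1 − g′⁻¹g)‖ ≤ N_m(g′)·‖g − g′‖`).
[cite: Balaban1985Averaging, (9) p.19, (19)-(20) p.21; Balaban1985BackgroundPropagators, (3.3)-(3.4) pp.390-391, (3.8) p.392] -/
theorem comm_double_chain_le (T P T' P' g g' : ℕ → 𝔸ˣ)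
    (hT : ∀ k, ‖(T k : 𝔸)‖ ≤ 1 ∧ ‖(((T k)⁻¹ : 𝔸ˣ) : 𝔸)‖ ≤ 1) (hP : ∀ k, ‖(P k : 𝔸)‖ ≤ 1 ∧ ‖(((P k)⁻¹ : 𝔸ˣ) : 𝔸)‖ ≤ 1)
    (h0 : g 0 = 1) (hs : ∀ k, g (k + 1) = (T k * P k * (T k)⁻¹) * g k)
    (hT' : ∀ k, ‖(T' k : 𝔸)‖ ≤ 1 ∧ ‖(((T' k)⁻¹ : 𝔸ˣ) : 𝔸)‖ ≤ 1) (hP' : ∀ k, ‖(P' k : 𝔸)‖ ≤ 1 ∧ ‖(((P' k)⁻¹ : 𝔸ˣ) : 𝔸)‖ ≤ 1)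
    (hg' : ∀ k, ‖(g' k : 𝔸)‖ ≤ 1 ∧ ‖(((g' k)⁻¹ : 𝔸ˣ) : 𝔸)‖ ≤ 1) (h0' : g' 0 = 1) (hs' : ∀ k, g' (k + 1) = (T' k * P' k * (T' k)⁻¹) * g' k) (m : 𝔸) (n : ℕ) :
    ‖(((g' n)⁻¹ * g n : 𝔸ˣ) : 𝔸) * m - m * (((g' n)⁻¹ * g n : 𝔸ˣ) : 𝔸)‖
      ≤ ∑ k ∈ Finset.range n, ‖(((T k * P k * (T k)⁻¹ : 𝔸ˣ) : 𝔸) - ((T' k * P' k * (T' k)⁻¹ : 𝔸ˣ) : 𝔸)) * m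
            - m * (((T k * P k * (T k)⁻¹ : 𝔸ˣ) : 𝔸) - ((T' k * P' k * (T' k)⁻¹ : 𝔸ˣ) : 𝔸))‖
        + ∑ k ∈ Finset.range n, (‖(P k : 𝔸) * R (T k)⁻¹ m - R (T k)⁻¹ m * (P k : 𝔸)‖
              * ∑ i ∈ Finset.range k, ‖((T i * P i * (T i)⁻¹ : 𝔸ˣ) : 𝔸) - ((T' i * P' i * (T' i)⁻¹ : 𝔸ˣ) : 𝔸)‖
            + ‖((T k * P k * (T k)⁻¹ : 𝔸ˣ) : 𝔸) - ((T' k * P' k * (T' k)⁻¹ : 𝔸ˣ) : 𝔸)‖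
              * ∑ i ∈ Finset.range k, ‖(P' i : 𝔸) * R (T' i)⁻¹ m - R (T' i)⁻¹ m * (P' i : 𝔸)‖)
        + (∑ i ∈ Finset.range n, ‖(P' i : 𝔸) * R (T' i)⁻¹ m - R (T' i)⁻¹ m * (P' i : 𝔸)‖)
          * ∑ k ∈ Finset.range n, ‖((T k * P k * (T k)⁻¹ : 𝔸ˣ) : 𝔸) - ((T' k * P' k * (T' k)⁻¹ : 𝔸ˣ) : 𝔸)‖ := by
  rw [comm_inv_mul_eq]
  have hinv : ‖(((g' n)⁻¹ : 𝔸ˣ) : 𝔸)‖ ≤ 1 := (hg' n).2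
  have hA := comm_chain_sub_chain_le T P T' P' g g' hT hP h0 hs hT' hP' hg' h0' hs' m n
  have hXn := norm_chain_sub_chain_le T P T' P' g g' hT hP h0 hs hg' h0' hs' n
  have hB : ‖(g' n : 𝔸) * m - m * (g' n : 𝔸)‖ ≤ ∑ i ∈ Finset.range n, ‖(P' i : 𝔸) * R (T' i)⁻¹ m - R (T' i)⁻¹ m * (P' i : 𝔸)‖ :=
    comm_chain_le T' P' g' hT' hP' hg' h0' hs' m n
  -- `1 − g′⁻¹g = g′⁻¹(g′ − g)`
  have e1 : (1 : 𝔸) - (((g' n)⁻¹ : 𝔸ˣ) : 𝔸) * (g n : 𝔸) = (((g' n)⁻¹ : 𝔸ˣ) : 𝔸) * ((g' n : 𝔸) - (g n : 𝔸)) := by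
    rw [mul_sub, Units.inv_mul]
  have h1n : ‖(1 : 𝔸) - (((g' n)⁻¹ : 𝔸ˣ) : 𝔸) * (g n : 𝔸)‖ ≤ ‖(g n : 𝔸) - (g' n : 𝔸)‖ := by
    rw [e1, norm_sub_rev (g n : 𝔸)]
    exact (norm_mul_le _ _).trans (by nlinarith [norm_nonneg ((g' n : 𝔸) - (g n : 𝔸))])
  have ediff : ((g n : 𝔸) * m - m * (g n : 𝔸)) - ((g' n : 𝔸) * m - m * (g' n : 𝔸)) = ((g n : 𝔸) - (g' n : 𝔸)) * m - m * ((g n : 𝔸) - (g' n : 𝔸)) := by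
    noncomm_ring
  refine (norm_add_le _ _).trans ?_
  have t1 : ‖(((g' n)⁻¹ : 𝔸ˣ) : 𝔸) * (((g n : 𝔸) * m - m * (g n : 𝔸)) - ((g' n : 𝔸) * m - m * (g' n : 𝔸)))‖
      ≤ ‖((g n : 𝔸) - (g' n : 𝔸)) * m - m * ((g n : 𝔸) - (g' n : 𝔸))‖ := by
    rw [ediff]; exact (norm_mul_le _ _).trans (by nlinarith [norm_nonneg (((g n : 𝔸) - (g' n : 𝔸)) * m - m * ((g n : 𝔸) - (g' n : 𝔸)))])
  have t2 : ‖(((g' n)⁻¹ : 𝔸ˣ) : 𝔸) * ((g' n : 𝔸) * m - m * (g' n : 𝔸)) * (1 - (((g' n)⁻¹ : 𝔸ˣ) : 𝔸) * (g n : 𝔸))‖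
      ≤ (∑ i ∈ Finset.range n, ‖(P' i : 𝔸) * R (T' i)⁻¹ m - R (T' i)⁻¹ m * (P' i : 𝔸)‖)
          * ∑ k ∈ Finset.range n, ‖((T k * P k * (T k)⁻¹ : 𝔸ˣ) : 𝔸) - ((T' k * P' k * (T' k)⁻¹ : 𝔸ˣ) : 𝔸)‖ := by
    calc ‖(((g' n)⁻¹ : 𝔸ˣ) : 𝔸) * ((g' n : 𝔸) * m - m * (g' n : 𝔸)) * (1 - (((g' n)⁻¹ : 𝔸ˣ) : 𝔸) * (g n : 𝔸))‖
        ≤ ‖(((g' n)⁻¹ : 𝔸ˣ) : 𝔸)‖ * ‖(g' n : 𝔸) * m - m * (g' n : 𝔸)‖ * ‖1 - (((g' n)⁻¹ : 𝔸ˣ) : 𝔸) * (g n : 𝔸)‖ :=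
          (norm_mul_le _ _).trans (mul_le_mul_of_nonneg_right (norm_mul_le _ _) (norm_nonneg _))
      _ ≤ 1 * (∑ i ∈ Finset.range n, ‖(P' i : 𝔸) * R (T' i)⁻¹ m - R (T' i)⁻¹ m * (P' i : 𝔸)‖)
            * ∑ k ∈ Finset.range n, ‖((T k * P k * (T k)⁻¹ : 𝔸ˣ) : 𝔸) - ((T' k * P' k * (T' k)⁻¹ : 𝔸ˣ) : 𝔸)‖ :=
          mul_le_mul (mul_le_mul hinv hB (norm_nonneg _) zero_le_one) (h1n.trans hXn) (norm_nonneg _) (by positivity)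
      _ = _ := by rw [one_mul]
  linarith [t1, t2, hA]

/-- ★★ **THE DOUBLE CHAIN RULE, SMALL-FIELD FORM**: if every plaquette is within `a ≥ 0` of `1` (`‖P_k − 1‖, ‖P′_k − 1‖ ≤ a`), then
`N_m(g′(n)⁻¹g(n)) ≤ Σ_(k<n) N_m(C_k − C′_k) + 2a·n·(Σ_(k<n) N_(R(T_k⁻¹)m)(P_k) + 2·Σ_(k<n) N_(R(T′_k⁻¹)m)(P′_k))` — second order = `a·n` times the two single-ladder families
(✓ `comm_chain_le`'s right sides). [cite: Balaban1985Averaging, (19)-(20) p.21; Balaban1985BackgroundPropagators, (3.3)-(3.4) pp.390-391] -/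
theorem comm_double_chain_le_of_small (T P T' P' g g' : ℕ → 𝔸ˣ)
    (hT : ∀ k, ‖(T k : 𝔸)‖ ≤ 1 ∧ ‖(((T k)⁻¹ : 𝔸ˣ) : 𝔸)‖ ≤ 1) (hP : ∀ k, ‖(P k : 𝔸)‖ ≤ 1 ∧ ‖(((P k)⁻¹ : 𝔸ˣ) : 𝔸)‖ ≤ 1)
    (h0 : g 0 = 1) (hs : ∀ k, g (k + 1) = (T k * P k * (T k)⁻¹) * g k)
    (hT' : ∀ k, ‖(T' k : 𝔸)‖ ≤ 1 ∧ ‖(((T' k)⁻¹ : 𝔸ˣ) : 𝔸)‖ ≤ 1) (hP' : ∀ k, ‖(P' k : 𝔸)‖ ≤ 1 ∧ ‖(((P' k)⁻¹ : 𝔸ˣ) : 𝔸)‖ ≤ 1)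
    (hg' : ∀ k, ‖(g' k : 𝔸)‖ ≤ 1 ∧ ‖(((g' k)⁻¹ : 𝔸ˣ) : 𝔸)‖ ≤ 1) (h0' : g' 0 = 1) (hs' : ∀ k, g' (k + 1) = (T' k * P' k * (T' k)⁻¹) * g' k)
    {a : ℝ} (ha : 0 ≤ a) (hPa : ∀ k, ‖(P k : 𝔸) - 1‖ ≤ a) (hP'a : ∀ k, ‖(P' k : 𝔸) - 1‖ ≤ a) (m : 𝔸) (n : ℕ) :
    ‖(((g' n)⁻¹ * g n : 𝔸ˣ) : 𝔸) * m - m * (((g' n)⁻¹ * g n : 𝔸ˣ) : 𝔸)‖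
      ≤ ∑ k ∈ Finset.range n, ‖(((T k * P k * (T k)⁻¹ : 𝔸ˣ) : 𝔸) - ((T' k * P' k * (T' k)⁻¹ : 𝔸ˣ) : 𝔸)) * m
            - m * (((T k * P k * (T k)⁻¹ : 𝔸ˣ) : 𝔸) - ((T' k * P' k * (T' k)⁻¹ : 𝔸ˣ) : 𝔸))‖
        + 2 * a * n * (∑ k ∈ Finset.range n, ‖(P k : 𝔸) * R (T k)⁻¹ m - R (T k)⁻¹ m * (P k : 𝔸)‖
            + 2 * ∑ k ∈ Finset.range n, ‖(P' k : 𝔸) * R (T' k)⁻¹ m - R (T' k)⁻¹ m * (P' k : 𝔸)‖) := by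
  have main := comm_double_chain_le T P T' P' g g' hT hP h0 hs hT' hP' hg' h0' hs' m n
  set D : ℕ → ℝ := fun k => ‖((T k * P k * (T k)⁻¹ : 𝔸ˣ) : 𝔸) - ((T' k * P' k * (T' k)⁻¹ : 𝔸ˣ) : 𝔸)‖ with hD
  set N : ℕ → ℝ := fun k => ‖(P k : 𝔸) * R (T k)⁻¹ m - R (T k)⁻¹ m * (P k : 𝔸)‖ with hN
  set N' : ℕ → ℝ := fun k => ‖(P' k : 𝔸) * R (T' k)⁻¹ m - R (T' k)⁻¹ m * (P' k : 𝔸)‖ with hN'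
  have hDle : ∀ k, D k ≤ 2 * a := fun k => by
    have := norm_rung_sub_rung_le (hT k) (hT' k) (P k) (P' k)
    simp only [hD]; linarith [hPa k, hP'a k]
  have hD0 : ∀ k, 0 ≤ D k := fun k => norm_nonneg _
  have hN0 : ∀ k, 0 ≤ N k := fun k => norm_nonneg _
  have hN'0 : ∀ k, 0 ≤ N' k := fun k => norm_nonneg _
  -- partial sums are at most `2a·n` resp. the full sums
  have hDsum : ∀ k, k ≤ n → ∑ i ∈ Finset.range k, D i ≤ 2 * a * n := fun k hk => by
    calc ∑ i ∈ Finset.range k, D i ≤ ∑ i ∈ Finset.range k, 2 * a := Finset.sum_le_sum fun i _ => hDle i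
      _ = 2 * a * k := by rw [Finset.sum_const, Finset.card_range, nsmul_eq_mul]; ring
      _ ≤ 2 * a * n := by have : (k : ℝ) ≤ n := by exact_mod_cast hk
                          nlinarith
  have hN'sum : ∀ k, k ≤ n → ∑ i ∈ Finset.range k, N' i ≤ ∑ i ∈ Finset.range n, N' i := fun k hk =>
    Finset.sum_le_sum_of_subset_of_nonneg (Finset.range_mono hk) fun i _ _ => hN'0 i
  have hS0 : 0 ≤ ∑ i ∈ Finset.range n, N' i := Finset.sum_nonneg fun i _ => hN'0 i
  -- the middle sum
  have hmid : ∑ k ∈ Finset.range n, (N k * ∑ i ∈ Finset.range k, D i + D k * ∑ i ∈ Finset.range k, N' i)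
      ≤ 2 * a * n * ∑ k ∈ Finset.range n, N k + 2 * a * n * ∑ i ∈ Finset.range n, N' i := by
    have step : ∀ k ∈ Finset.range n, N k * ∑ i ∈ Finset.range k, D i + D k * ∑ i ∈ Finset.range k, N' i
        ≤ N k * (2 * a * n) + 2 * a * ∑ i ∈ Finset.range n, N' i := fun k hk => by
      have hkn : k ≤ n := (Finset.mem_range.mp hk).le
      exact add_le_add (mul_le_mul_of_nonneg_left (hDsum k hkn) (hN0 k))
        (mul_le_mul (hDle k) (hN'sum k hkn) (Finset.sum_nonneg fun i _ => hN'0 i) (by positivity))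
    refine (Finset.sum_le_sum step).trans (le_of_eq ?_)
    rw [Finset.sum_add_distrib, ← Finset.sum_mul, Finset.sum_const, Finset.card_range, nsmul_eq_mul]
    ring
  have hlast : (∑ i ∈ Finset.range n, N' i) * ∑ k ∈ Finset.range n, D k ≤ 2 * a * n * ∑ i ∈ Finset.range n, N' i := by
    have := mul_le_mul_of_nonneg_left (hDsum n le_rfl) hS0
    linarith
  linarith [main, hmid, hlast]

/-- the double chain rule read on the conjugation: `‖R(g′(n)⁻¹g(n))m − m‖ ≤` the small-field bound of ✓ `comm_double_chain_le_of_small` (✓ `norm_R_sub_self_le_comm_of_inv`).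
[cite: Balaban1985BackgroundPropagators, (3.3) p.390] -/
theorem norm_R_double_chain_sub_self_le (T P T' P' g g' : ℕ → 𝔸ˣ)
    (hT : ∀ k, ‖(T k : 𝔸)‖ ≤ 1 ∧ ‖(((T k)⁻¹ : 𝔸ˣ) : 𝔸)‖ ≤ 1) (hP : ∀ k, ‖(P k : 𝔸)‖ ≤ 1 ∧ ‖(((P k)⁻¹ : 𝔸ˣ) : 𝔸)‖ ≤ 1)
    (hg : ∀ k, ‖(g k : 𝔸)‖ ≤ 1 ∧ ‖(((g k)⁻¹ : 𝔸ˣ) : 𝔸)‖ ≤ 1) (h0 : g 0 = 1) (hs : ∀ k, g (k + 1) = (T k * P k * (T k)⁻¹) * g k)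
    (hT' : ∀ k, ‖(T' k : 𝔸)‖ ≤ 1 ∧ ‖(((T' k)⁻¹ : 𝔸ˣ) : 𝔸)‖ ≤ 1) (hP' : ∀ k, ‖(P' k : 𝔸)‖ ≤ 1 ∧ ‖(((P' k)⁻¹ : 𝔸ˣ) : 𝔸)‖ ≤ 1)
    (hg' : ∀ k, ‖(g' k : 𝔸)‖ ≤ 1 ∧ ‖(((g' k)⁻¹ : 𝔸ˣ) : 𝔸)‖ ≤ 1) (h0' : g' 0 = 1) (hs' : ∀ k, g' (k + 1) = (T' k * P' k * (T' k)⁻¹) * g' k)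
    {a : ℝ} (ha : 0 ≤ a) (hPa : ∀ k, ‖(P k : 𝔸) - 1‖ ≤ a) (hP'a : ∀ k, ‖(P' k : 𝔸) - 1‖ ≤ a) (m : 𝔸) (n : ℕ) :
    ‖R ((g' n)⁻¹ * g n) m - m‖
      ≤ ∑ k ∈ Finset.range n, ‖(((T k * P k * (T k)⁻¹ : 𝔸ˣ) : 𝔸) - ((T' k * P' k * (T' k)⁻¹ : 𝔸ˣ) : 𝔸)) * m
            - m * (((T k * P k * (T k)⁻¹ : 𝔸ˣ) : 𝔸) - ((T' k * P' k * (T' k)⁻¹ : 𝔸ˣ) : 𝔸))‖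
        + 2 * a * n * (∑ k ∈ Finset.range n, ‖(P k : 𝔸) * R (T k)⁻¹ m - R (T k)⁻¹ m * (P k : 𝔸)‖
            + 2 * ∑ k ∈ Finset.range n, ‖(P' k : 𝔸) * R (T' k)⁻¹ m - R (T' k)⁻¹ m * (P' k : 𝔸)‖) := by
  have hinv : ‖((((g' n)⁻¹ * g n)⁻¹ : 𝔸ˣ) : 𝔸)‖ ≤ 1 := by
    rw [mul_inv_rev, inv_inv, Units.val_mul]
    exact (norm_mul_le _ _).trans (by nlinarith [(hg n).2, (hg' n).1, norm_nonneg (((g n)⁻¹ : 𝔸ˣ) : 𝔸), norm_nonneg ((g' n : 𝔸ˣ) : 𝔸)])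
  exact (norm_R_sub_self_le_comm_of_inv hinv m).trans (comm_double_chain_le_of_small T P T' P' g g' hT hP h0 hs hT' hP' hg' h0' hs' ha hPa hP'a m n)

end Double

end Summit.QuantumFields.YangMills.Theorems.Prop7DoubleCommutatorChain

end
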